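import Summits.Ventures.HSemireg.WedgeHankelRecurrenceGaussChebyshevRationalRoots

/-!
# Venture HSemireg — **THE RATIONAL ROOTS OF THE CHEBYSHEV POLYNOMIALS `U_n`, `T_n`: `(U_n over ℚ).roots = [n odd]·{0} + [n ≡ 2 (mod 3)]·{1∕2, −1∕2}` and `(T_n over ℚ).roots = [n odd]·{0}`**
# (transport of N519 along `S_n(2X) = U_n(X)`, `C_n(2X) = 2T_n(X)` with Mathlib `map_roots_comp_C_mul_X_add_C`), with the values `U_n(⅟2) = S_n(1)`, `2T_n(⅟2) = C_n(1)` over every ring with `⅟2`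

HONEST FRAMING. Part of the Lean index of the computation cell `pub-hsemireg` (seat p10 gen 49, Sunday typer «UNIFORM-IN-n»).  Polynomial algebra over a commutative ring (Mathlib
`Polynomial.Chebyshev.S ∕ C ∕ U ∕ T`) and Mathlib's Niven theorem on top of N519; no variety, no cohomology theory, no sheaf, no Ext group and no semiregularity map is constructed here; nothing
here says that HC / HC_CM / HC_AV holds; no Literature fact (unproved `Prop`) is declared or used.  Custodian versions as in `WedgeHankelSiegelIdeal` (1/3).
SOURCES (cited).  I. Niven, *Irrational Numbers* (Carus Monograph 11, 1956), Cor. 3.12 (Mathlib `niven`); T. J. Rivlin, *The Chebyshev Polynomials* (Wiley 1974), §1.2 (roots `cos((2k+1)π∕2n)` of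
`T_n`, `cos(kπ∕(n+1))` of `U_n`); D. A. Wolfram, *Factoring variants of Chebyshev polynomials with minimal polynomials of `cos(2π∕d)`*, arXiv:2106.14585.
PROOF TYPED HERE.  (1) `U_n = S_n ∘ (2X)` and `2T_n = C_n ∘ (2X)` (Mathlib `S_comp_two_mul_X`, `C_comp_two_mul_X`), so `U_n(⅟2) = S_n(1)`, `2T_n(⅟2) = C_n(1)` and the root criteria of N519 at `±1`
transport to `±⅟2`; at `0` they transport verbatim (`U_n(0) = S_n(0)`, and `T_{2m}(0) = (−1)^m` is a unit).  (2) Over `ℚ`: Mathlib `map_roots_comp_C_mul_X_add_C` (`a = 2`, `b = 0`) gives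
`(U_n).roots.map (2·) = (S_n).roots` and `(2T_n).roots.map (2·) = (C_n).roots`, and N519 `chebyshevS_roots_rat ∕ chebyshevC_roots_rat` finish.  (3) Over `ℝ`: a rational real root of `U_n` is
`cos(rπ)`, `r = (k+1)∕(n+1) ∈ (0,1)` (Mathlib `roots_U_real`), hence `∈ {−1∕2, 0, 1∕2}` by Niven (N519 `two_mul_cos_rat_mul_pi_of_rational`); for `T_n` this is Mathlib's `irrational_of_isRoot_T_real`
(a rational real root is `0`), which is USED, not restated.
DEDUP DISCLOSURE (`rg -n 'invOf_two|one_half|roots_rat|isRoot_zero_iff' Summits/Ventures/HSemireg -g 'WedgeHankelRecurrenceGaussChebyshev*'`, `lean search 'irrational_of_isRoot'`, 2026-09-04):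
Mathlib has `irrational_of_isRoot_T_real` (`T` only), `U_eval_zero`, `U_eval_zero_of_odd`, `T_eval_zero_of_odd`, `T_eval_two_mul_zero`, `roots_T_real`, `roots_U_real`, but no value of `U_n`, `T_n` at
`±1∕2` and no rational root multiset; the tree has N519 (the `S ∕ C` versions) only; 0 hits for the 15 names below.

WHAT IS IN THE TREE.  N519 `chebyshevS_isRoot_one_iff`, `chebyshevS_isRoot_neg_one_iff`, `chebyshevS_isRoot_zero_iff`, `chebyshevS_eval_zero_eq_U_eval_zero`, `chebyshevC_eval_one_ne_zero`,
`chebyshevC_eval_neg_one_ne_zero`, `two_mul_cos_rat_mul_pi_of_rational`, `chebyshevS_roots_rat`, `chebyshevC_roots_rat`; Mathlib `S_comp_two_mul_X`, `C_comp_two_mul_X`, `U_eval_neg`, `T_eval_neg`,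
`T_eval_zero_of_odd`, `T_eval_two_mul_zero`, `map_roots_comp_C_mul_X_add_C`, `roots_C_mul`, `roots_U_real`, `irrational_of_isRoot_T_real`, `Int.cast_negOnePow_natCast`.
THIS FILE (namespace `Summit.Ventures.HSemireg.Wedge.HankelOuter` continued; CHAINED on N519; 0 definitions):
* §1285 `chebyshevU_eval_invOf_two` (`U_n(⅟2) = S_n(1)`), `two_mul_chebyshevT_eval_invOf_two` (`2T_n(⅟2) = C_n(1)`), **`chebyshevU_isRoot_invOf_two_iff`**, **`chebyshevU_isRoot_neg_invOf_two_iff`**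
  (`↔ n % 3 = 2`), **`chebyshevU_isRoot_zero_iff`** (`↔ Odd n`), **`chebyshevT_isRoot_zero_iff`** (`↔ Odd n`, nontrivial ring), **`chebyshevT_eval_invOf_two_ne_zero`**,
  **`chebyshevT_eval_neg_invOf_two_ne_zero`** (`char 0`); `cos_rat_mul_pi_of_rational` (Niven on `(0, π)` for `cos`), **`chebyshevU_roots_real_rational`** (a rational real root is `−1∕2`, `0` or `1∕2`),
  **`chebyshevT_roots_real_rational`** (it is `0`; from Mathlib `irrational_of_isRoot_T_real`), **`chebyshevU_roots_rat_map_two_mul`**, **`chebyshevU_roots_rat`**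
  (`(U_n over ℚ).roots = [n odd]·{0} + [n ≡ 2 (3)]·{1∕2, −1∕2}`), **`chebyshevT_roots_rat_map_two_mul`**, **`chebyshevT_roots_rat`** (`(T_n over ℚ).roots = [n odd]·{0}`).
CAVEATS.  The `IsRoot` criteria at `±⅟2` need `⅟2` (and characteristic `0` for `T_n`); the rational root multisets are stated over `ℚ` only.  Nothing Ext-side.  New names only.
-/

open Module Polynomial
open scoped Matrix Polynomial

namespace Summit.Ventures.HSemireg.Wedge.HankelOuter

/-! ## §1285. Rational roots of `U_n` and `T_n` -/

/-! ### Values at `⅟2` and `0` over a commutative ring -/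

/-- `U_n(⅟2) = S_n(1)` (`S_n(2X) = U_n(X)` at `X = ⅟2`). [Rivlin 1974, §1.2; this file, §1285] -/
theorem chebyshevU_eval_invOf_two {R : Type*} [CommRing R] [Invertible (2 : R)] (n : ℤ) :
    (Polynomial.Chebyshev.U R n).eval (⅟2) = (Polynomial.Chebyshev.S R n).eval 1 := by
  have h := congrArg (Polynomial.eval (⅟2 : R)) (Polynomial.Chebyshev.S_comp_two_mul_X R n)
  rw [eval_comp, eval_mul, eval_ofNat, eval_X, mul_invOf_self] at h
  exact h.symm

/-- `2T_n(⅟2) = C_n(1)` (`C_n(2X) = 2T_n(X)` at `X = ⅟2`). [Rivlin 1974, §1.2; this file, §1285] -/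
theorem two_mul_chebyshevT_eval_invOf_two {R : Type*} [CommRing R] [Invertible (2 : R)] (n : ℤ) :
    2 * (Polynomial.Chebyshev.T R n).eval (⅟2) = (Polynomial.Chebyshev.C R n).eval 1 := by
  have h := congrArg (Polynomial.eval (⅟2 : R)) (Polynomial.Chebyshev.C_comp_two_mul_X R n)
  rw [eval_comp, eval_mul, eval_ofNat, eval_X, mul_invOf_self, eval_mul, eval_ofNat] at h
  exact h.symm

/-- **`⅟2` is a root of `U_n` iff `n ≡ 2 (mod 3)`** (nontrivial ring with `⅟2`). [this file, §1285] -/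
theorem chebyshevU_isRoot_invOf_two_iff {R : Type*} [CommRing R] [Nontrivial R] [Invertible (2 : R)] (n : ℕ) :
    (Polynomial.Chebyshev.U R (n : ℤ)).IsRoot (⅟2) ↔ n % 3 = 2 := by
  rw [IsRoot.def, chebyshevU_eval_invOf_two, ← IsRoot.def, chebyshevS_isRoot_one_iff]

/-- **`−⅟2` is a root of `U_n` iff `n ≡ 2 (mod 3)`** (nontrivial ring with `⅟2`; parity `U_n(−x) = (−1)^n U_n(x)`). [this file, §1285] -/
theorem chebyshevU_isRoot_neg_invOf_two_iff {R : Type*} [CommRing R] [Nontrivial R] [Invertible (2 : R)] (n : ℕ) :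
    (Polynomial.Chebyshev.U R (n : ℤ)).IsRoot (-⅟2) ↔ n % 3 = 2 := by
  rw [IsRoot.def, Polynomial.Chebyshev.U_eval_neg, Int.cast_negOnePow_natCast, ((isUnit_one (M := R)).neg.pow n).mul_right_eq_zero, ← IsRoot.def,
    chebyshevU_isRoot_invOf_two_iff]

/-- **`0` is a root of `U_n` iff `n` is odd** (nontrivial ring; `U_n(0) = S_n(0)`). [this file, §1285] -/
theorem chebyshevU_isRoot_zero_iff {R : Type*} [CommRing R] [Nontrivial R] (n : ℕ) : (Polynomial.Chebyshev.U R (n : ℤ)).IsRoot 0 ↔ Odd n := by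
  rw [IsRoot.def, ← chebyshevS_eval_zero_eq_U_eval_zero, ← IsRoot.def, chebyshevS_isRoot_zero_iff]

/-- **`0` is a root of `T_n` iff `n` is odd** (nontrivial ring; `T_{2m}(0) = (−1)^m` is a unit). [Mathlib `T_eval_zero_of_odd`, `T_eval_two_mul_zero`; this file, §1285] -/
theorem chebyshevT_isRoot_zero_iff {R : Type*} [CommRing R] [Nontrivial R] (n : ℕ) : (Polynomial.Chebyshev.T R (n : ℤ)).IsRoot 0 ↔ Odd n := by
  rw [IsRoot.def]
  rcases Nat.even_or_odd n with h | h
  · obtain ⟨m, rfl⟩ := h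
    rw [show ((m + m : ℕ) : ℤ) = 2 * (m : ℤ) by push_cast; ring, Polynomial.Chebyshev.T_eval_two_mul_zero, Int.cast_negOnePow_natCast]
    simp only [((isUnit_one (M := R)).neg.pow m).ne_zero, false_iff, Nat.not_odd_iff_even]
    exact ⟨m, rfl⟩
  · rw [Polynomial.Chebyshev.T_eval_zero_of_odd R ((Int.odd_coe_nat n).mpr h)]
    simp [h]

/-- **`T_n(⅟2) ≠ 0` in characteristic `0`** (`2T_n(⅟2) = C_n(1) ≠ 0`). [this file, §1285] -/
theorem chebyshevT_eval_invOf_two_ne_zero {R : Type*} [CommRing R] [CharZero R] [Invertible (2 : R)] (n : ℕ) : (Polynomial.Chebyshev.T R (n : ℤ)).eval (⅟2) ≠ 0 := by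
  intro h
  apply chebyshevC_eval_one_ne_zero (R := R) n
  rw [← two_mul_chebyshevT_eval_invOf_two, h, mul_zero]

/-- **`T_n(−⅟2) ≠ 0` in characteristic `0`.** [this file, §1285] -/
theorem chebyshevT_eval_neg_invOf_two_ne_zero {R : Type*} [CommRing R] [CharZero R] [Invertible (2 : R)] (n : ℕ) : (Polynomial.Chebyshev.T R (n : ℤ)).eval (-⅟2) ≠ 0 := by
  haveI : Nontrivial R := nontrivial_of_ne 1 0 one_ne_zero
  rw [Polynomial.Chebyshev.T_eval_neg, Int.cast_negOnePow_natCast, Ne, ((isUnit_one (M := R)).neg.pow n).mul_right_eq_zero]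
  exact chebyshevT_eval_invOf_two_ne_zero n

/-! ### Niven: a rational real root of `U_n` is `−1∕2`, `0` or `1∕2`; of `T_n` it is `0` -/

/-- Niven on `(0, π)` for `cos`: if `0 < r < 1` and `cos(rπ)` is rational then `cos(rπ) ∈ {−1∕2, 0, 1∕2}`. [Niven 1956, Cor. 3.12 (Mathlib `niven`); this file, §1285] -/
theorem cos_rat_mul_pi_of_rational {r : ℚ} (h0 : 0 < r) (h1 : r < 1) (hq : ∃ q : ℚ, Real.cos (r * Real.pi) = q) :
    Real.cos (r * Real.pi) = -(1 / 2) ∨ Real.cos (r * Real.pi) = 0 ∨ Real.cos (r * Real.pi) = 1 / 2 := by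
  obtain ⟨q, hq⟩ := hq
  rcases two_mul_cos_rat_mul_pi_of_rational h0 h1 ⟨2 * q, by rw [hq]; push_cast; ring⟩ with h | h | h
  · exact Or.inl (by linarith)
  · exact Or.inr (Or.inl (by linarith))
  · exact Or.inr (Or.inr (by linarith))

/-- **A rational real root of `U_n` is `−1∕2`, `0` or `1∕2`.** [Niven 1956, Cor. 3.12; this file, §1285] -/
theorem chebyshevU_roots_real_rational {n : ℕ} {x : ℝ} (hx : x ∈ (Polynomial.Chebyshev.U ℝ (n : ℤ)).roots) (hq : ∃ q : ℚ, x = q) : x = -(1 / 2) ∨ x = 0 ∨ x = 1 / 2 := by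
  rw [Polynomial.Chebyshev.roots_U_real, Finset.mem_val, Finset.mem_image] at hx
  obtain ⟨k, hk, rfl⟩ := hx
  rw [Finset.mem_range] at hk
  have hr : (k + 1 : ℝ) * Real.pi / (n + 1) = ((((k + 1 : ℕ) : ℚ) / ((n + 1 : ℕ) : ℚ) : ℚ) : ℝ) * Real.pi := by
    rw [Rat.cast_div, Rat.cast_natCast, Rat.cast_natCast]; push_cast; ring
  have hq' : ∃ q : ℚ, Real.cos (((((k + 1 : ℕ) : ℚ) / ((n + 1 : ℕ) : ℚ) : ℚ) : ℝ) * Real.pi) = q := by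
    obtain ⟨q, hq⟩ := hq
    exact ⟨q, by rw [← hr, hq]⟩
  rw [hr]
  refine cos_rat_mul_pi_of_rational (by positivity) ?_ hq'
  rw [div_lt_one (by positivity)]
  exact_mod_cast (by omega : k + 1 < n + 1)

/-- **A rational real root of `T_n` is `0`** (Mathlib `irrational_of_isRoot_T_real`, restated for the root multiset). [Niven 1956, Cor. 3.12; this file, §1285] -/
theorem chebyshevT_roots_real_rational {n : ℕ} {x : ℝ} (hx : x ∈ (Polynomial.Chebyshev.T ℝ (n : ℤ)).roots) (hq : ∃ q : ℚ, x = q) : x = 0 := by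
  by_contra h0
  obtain ⟨q, rfl⟩ := hq
  exact Polynomial.Chebyshev.irrational_of_isRoot_T_real ((mem_roots (Polynomial.Chebyshev.T_ne_zero ℝ (n : ℤ))).mp hx) h0 ⟨q, rfl⟩

/-! ### The rational root multisets -/

/-- **`(U_n over ℚ).roots.map (2·) = (S_n over ℚ).roots = [n odd]·{0} + [n ≡ 2 (mod 3)]·{1, −1}`** (`U_n = S_n ∘ 2X`). [Niven 1956, Cor. 3.12; Wolfram 2021; this file, §1285] -/
theorem chebyshevU_roots_rat_map_two_mul (n : ℕ) :
    (Polynomial.Chebyshev.U ℚ (n : ℤ)).roots.map (fun x => 2 * x) = (if Odd n then {0} else 0) + (if n % 3 = 2 then {1, -1} else 0) := by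
  rw [← chebyshevS_roots_rat, ← Polynomial.Chebyshev.S_comp_two_mul_X]
  have h := Polynomial.map_roots_comp_C_mul_X_add_C (Polynomial.Chebyshev.S ℚ (n : ℤ)) 2 0 (isUnit_iff_ne_zero.mpr two_ne_zero)
  rw [Polynomial.C_0, add_zero, Polynomial.C_ofNat] at h
  simp only [add_zero] at h
  exact h

/-- **The rational roots of `U_n`: `(U_n over ℚ).roots = [n odd]·{0} + [n ≡ 2 (mod 3)]·{1∕2, −1∕2}`** (all simple). [Niven 1956, Cor. 3.12; Wolfram 2021; this file, §1285] -/
theorem chebyshevU_roots_rat (n : ℕ) :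
    (Polynomial.Chebyshev.U ℚ (n : ℤ)).roots = (if Odd n then {0} else 0) + (if n % 3 = 2 then {1 / 2, -1 / 2} else 0) := by
  have h : ((Polynomial.Chebyshev.U ℚ (n : ℤ)).roots.map (fun x => 2 * x)).map (fun x => x / 2) =
      (((if Odd n then {0} else 0) + (if n % 3 = 2 then {1, -1} else 0) : Multiset ℚ)).map (fun x => x / 2) := by
    rw [chebyshevU_roots_rat_map_two_mul]
  rw [Multiset.map_map] at h
  have hid : ((fun x : ℚ => x / 2) ∘ fun x : ℚ => 2 * x) = id := by
    funext x
    simp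
  rw [hid, Multiset.map_id, Multiset.map_add] at h
  rw [h]
  congr 1 <;> split_ifs <;> simp

/-- **`(T_n over ℚ).roots.map (2·) = (C_n over ℚ).roots = [n odd]·{0}`** (`2T_n = C_n ∘ 2X`). [Niven 1956, Cor. 3.12; this file, §1285] -/
theorem chebyshevT_roots_rat_map_two_mul (n : ℕ) : (Polynomial.Chebyshev.T ℚ (n : ℤ)).roots.map (fun x => 2 * x) = if Odd n then {0} else 0 := by
  rw [← chebyshevC_roots_rat]
  have h := Polynomial.map_roots_comp_C_mul_X_add_C (Polynomial.Chebyshev.C ℚ (n : ℤ)) 2 0 (isUnit_iff_ne_zero.mpr two_ne_zero)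
  rw [Polynomial.C_0, add_zero, Polynomial.C_ofNat, Polynomial.Chebyshev.C_comp_two_mul_X, ← Polynomial.C_ofNat, roots_C_mul _ (two_ne_zero : (2 : ℚ) ≠ 0)] at h
  simp only [add_zero] at h
  exact h

/-- **The rational roots of `T_n`: `(T_n over ℚ).roots = [n odd]·{0}`** (`±1∕2` are never roots; `0` is a simple root iff `n` is odd). [Niven 1956, Cor. 3.12; Mathlib `irrational_of_isRoot_T_real`;
this file, §1285] -/
theorem chebyshevT_roots_rat (n : ℕ) : (Polynomial.Chebyshev.T ℚ (n : ℤ)).roots = if Odd n then {0} else 0 := by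
  have h : ((Polynomial.Chebyshev.T ℚ (n : ℤ)).roots.map (fun x => 2 * x)).map (fun x => x / 2) = ((if Odd n then {0} else 0 : Multiset ℚ)).map (fun x => x / 2) := by
    rw [chebyshevT_roots_rat_map_two_mul]
  rw [Multiset.map_map] at h
  have hid : ((fun x : ℚ => x / 2) ∘ fun x : ℚ => 2 * x) = id := by
    funext x
    simp
  rw [hid, Multiset.map_id] at h
  rw [h]
  split_ifs <;> simp

end Summit.Ventures.HSemireg.Wedge.HankelOuter
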